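import Literature.NumberTheory.LFunctions.PrimitiveQuadraticCharacterPrimeValues
import HarnessLib

/-!
# Primitive quadratic Dirichlet characters with values in ANY domain of characteristic zero are Kronecker symbols

Topic `Literature/NumberTheory/LFunctions`, namespace `Literature.NumberTheory.LFunctions.PrimitiveQuadratic` (continuing
`PrimitiveQuadraticCharacter.lean`, `…Modulus.lean`, `…Kronecker.lean`, `…KroneckerEven.lean`, `…PrimeValues.lean`, which
treat `ℂ`-valued characters). Everything here is PROVED (theorems only; no definitions, no named facts, no instances).

Montgomery–Vaughan's Theorem 9.13 («the primitive quadratic characters are exactly the Kronecker symbols `(D/·)` of the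
fundamental discriminants `D`, `χ(−1) = sign D`») is a statement about homomorphisms `(ℤ/q)ˣ → {±1}`; the coefficient
ring is immaterial. The tree proved it for `DirichletCharacter ℂ q`; consumers with `p`-ADIC coefficients (the
`DirichletCharacter ℚ_[p] m` of the Kriz–Li / Eisenstein-congruence files, where a CLASS DATUM carries an abstract primitive
quadratic `χ`) need it for `DirichletCharacter R q` with `R` any commutative ring of characteristic `0` (e.g. `ℚ_[p]`). This file TRANSPORTS the `ℂ`
results along the integer values:

* `exists_complex_twin` — a quadratic `R`-valued character `χ` mod `q` has integer values `v(a) ∈ {0, ±1}` and a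
  `ℂ`-valued twin `χ'` with the same values; `χ'` is quadratic, has the same parity, and **`χ` is primitive iff `χ'` is**
  (both conductors are read off the kernels `{u : χ(u) = 1}` through Mathlib's `factorsThrough_iff_ker_unitsMap`);
* transported statements (hypotheses: `χ : DirichletCharacter R q` primitive and quadratic; `s = χ(−1) ∈ {±1}` as an integer):
  `apply_natCast_eq_jacobiSym_of_charZero` (`q` odd squarefree: `χ(n) = (n/q)` for all `n`),
  `squarefree_of_isPrimitive_of_isQuadratic_of_charZero` (`q` odd ⟹ squarefree), `four_dvd_of_isPrimitive_of_charZero`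
  (`q` even ⟹ `4 ∣ q`), `apply_natCast_eq_jacobiSym_sign_mul_of_charZero` (`χ(n) = (sq/n)` at odd `n`),
  `isFundamentalDiscriminant_sign_mul_of_charZero` (`sq` is a fundamental discriminant for `q > 1`),
  `apply_two_eq_ite_sign_mul_of_charZero` (`q` odd `> 1`: `χ(2) = ±1` by `sq mod 8`), `exists_sign_eq_of_charZero`.

## References
* [MontgomeryVaughan2007] H. L. Montgomery, R. C. Vaughan, *Multiplicative Number Theory I*, CUP 2007, §9.3, Theorem 9.13.
* [Cox2013] D. A. Cox, *Primes of the form x² + ny²*, 2nd ed., §1.C Lemma 1.14 (the value at `2`).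
-/

noncomputable section

open DirichletCharacter
open scoped NumberTheorySymbols Classical

namespace Literature.NumberTheory.LFunctions.PrimitiveQuadratic

variable {R : Type*} [CommRing R] [CharZero R]

/-! ### Integer values and the complex twin -/

omit [CharZero R] in
/-- A quadratic character (values in any commutative ring) has INTEGER values `v(a) ∈ {0, 1, −1}` with `χ(a) = v(a)`.
[cite: MontgomeryVaughan2007, Theorem 9.13] -/
theorem exists_int_values_of_isQuadratic {q : ℕ} (χ : DirichletCharacter R q) (hquad : χ.IsQuadratic) :
    ∃ v : ZMod q → ℤ, (∀ a, χ a = (v a : R)) ∧ ∀ a, v a = 0 ∨ v a = 1 ∨ v a = -1 := by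
  refine ⟨fun a => if χ a = 1 then 1 else if χ a = -1 then -1 else 0, fun a => ?_, fun a => ?_⟩
  · show χ a = ((if χ a = 1 then (1 : ℤ) else if χ a = -1 then -1 else 0 : ℤ) : R)
    by_cases h1 : χ a = 1
    · rw [if_pos h1, h1, Int.cast_one]
    · by_cases h2 : χ a = -1
      · rw [if_neg h1, if_pos h2, h2, Int.cast_neg, Int.cast_one]
      · rw [if_neg h1, if_neg h2, Int.cast_zero]
        rcases hquad a with h | h | h
        · exact h
        · exact absurd h h1
        · exact absurd h h2
  · show (if χ a = 1 then (1 : ℤ) else if χ a = -1 then -1 else 0) = 0 ∨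
      (if χ a = 1 then (1 : ℤ) else if χ a = -1 then -1 else 0) = 1 ∨
      (if χ a = 1 then (1 : ℤ) else if χ a = -1 then -1 else 0) = -1
    by_cases h1 : χ a = 1
    · rw [if_pos h1]; simp
    · by_cases h2 : χ a = -1
      · rw [if_neg h1, if_pos h2]; simp
      · rw [if_neg h1, if_neg h2]; simp

/-- **The complex twin.** A quadratic character `χ` mod `q` with values in a commutative ring `R` of characteristic `0` and a
`ℂ`-valued character `χ'` mod `q` take the SAME integer values; `χ'` is quadratic, `χ'(−1)` has the same sign, and `χ` is
primitive iff `χ'` is (the conductor of a character only depends on which units it sends to `1`,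
`DirichletCharacter.factorsThrough_iff_ker_unitsMap`). [cite: MontgomeryVaughan2007, Theorem 9.13] -/
theorem exists_complex_twin {q : ℕ} [NeZero q] (χ : DirichletCharacter R q) (hquad : χ.IsQuadratic) :
    ∃ (v : ZMod q → ℤ) (χ' : DirichletCharacter ℂ q), (∀ a, χ a = (v a : R)) ∧ (∀ a, χ' a = (v a : ℂ)) ∧
      χ'.IsQuadratic ∧ (χ.IsPrimitive ↔ χ'.IsPrimitive) := by
  obtain ⟨v, hv, hv3⟩ := exists_int_values_of_isQuadratic χ hquad
  -- the integer values are multiplicative, `1` at `1`, `0` off the units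
  have hv1 : v 1 = 1 := by
    have h := hv 1
    rw [map_one] at h
    exact_mod_cast h.symm
  have hvmul : ∀ a b, v (a * b) = v a * v b := fun a b => by
    have h := hv (a * b)
    rw [map_mul, hv a, hv b] at h
    exact_mod_cast h.symm
  have hv0 : ∀ a : ZMod q, ¬ IsUnit a → v a = 0 := fun a ha => by
    have h := hv a
    rw [χ.map_nonunit ha] at h
    exact_mod_cast h.symm
  let χ' : DirichletCharacter ℂ q :=
    { toFun := fun a => (v a : ℂ)
      map_one' := by simp only [hv1, Int.cast_one]
      map_mul' := fun a b => by simp only [hvmul, Int.cast_mul]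
      map_nonunit' := fun a ha => by simp only [hv0 a ha, Int.cast_zero] }
  have hχ' : ∀ a, χ' a = (v a : ℂ) := fun a => rfl
  refine ⟨v, χ', hv, hχ', fun a => ?_, ?_⟩
  · rw [hχ']
    rcases hv3 a with h | h | h <;> simp [h]
  · -- same kernels ⟹ same conductor
    have hker : χ.toUnitHom.ker = χ'.toUnitHom.ker := by
      ext u
      rw [MonoidHom.mem_ker, MonoidHom.mem_ker, Units.ext_iff, Units.ext_iff, MulChar.coe_toUnitHom,
        MulChar.coe_toUnitHom, Units.val_one, Units.val_one, hv, hχ']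
      constructor <;> intro h <;> exact_mod_cast (show v u = 1 by exact_mod_cast h)
    have hset : conductorSet χ = conductorSet χ' := by
      ext d
      rw [mem_conductorSet_iff, mem_conductorSet_iff]
      constructor
      · rintro ⟨hd, χ₀, hχ₀⟩
        exact (factorsThrough_iff_ker_unitsMap hd).mpr (hker ▸ (factorsThrough_iff_ker_unitsMap hd).mp ⟨hd, χ₀, hχ₀⟩)
      · rintro ⟨hd, χ₀, hχ₀⟩
        exact (factorsThrough_iff_ker_unitsMap hd).mpr
          (hker.symm ▸ (factorsThrough_iff_ker_unitsMap hd).mp ⟨hd, χ₀, hχ₀⟩)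
    rw [isPrimitive_def, isPrimitive_def, DirichletCharacter.conductor, DirichletCharacter.conductor, hset]

omit [CharZero R] in
/-- The sign `χ(−1) ∈ {1, −1}` of a Dirichlet character with values in a domain, as an integer:
`χ(−1) = s` with `s = 1` (`χ` even) or `s = −1` (`χ` odd). [cite: MontgomeryVaughan2007, Theorem 9.13] -/
theorem exists_sign_eq_of_charZero [NoZeroDivisors R] {q : ℕ} [NeZero q] (χ : DirichletCharacter R q) :
    ∃ s : ℤ, (s = 1 ∧ χ.Even ∨ s = -1 ∧ χ.Odd) ∧ χ (-1) = (s : R) := by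
  rcases χ.even_or_odd with h | h
  · exact ⟨1, Or.inl ⟨rfl, h⟩, by rw [Int.cast_one]; exact h⟩
  · exact ⟨-1, Or.inr ⟨rfl, h⟩, by rw [Int.cast_neg, Int.cast_one]; exact h⟩

/-- Transfer of the sign to the complex twin: if `χ(−1) = s` and `χ, χ'` have the same integer values, `χ'(−1) = s`.
[cite: MontgomeryVaughan2007, Theorem 9.13] -/
private theorem twin_sign {q : ℕ} {χ : DirichletCharacter R q} {χ' : DirichletCharacter ℂ q} {v : ZMod q → ℤ}
    (hv : ∀ a, χ a = (v a : R)) (hχ' : ∀ a, χ' a = (v a : ℂ)) {s : ℤ} (hs : χ (-1) = (s : R)) :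
    χ' (-1) = (s : ℂ) := by
  rw [hχ']
  have h : (v (-1) : R) = s := by rw [← hv, hs]
  exact_mod_cast (show v (-1) = s by exact_mod_cast h)

/-! ### The transported classification -/

/-- **Odd squarefree modulus** (values in any commutative ring of characteristic `0`): a primitive quadratic character `χ` mod `q`
is the Jacobi symbol, `χ(n) = (n/q)` for every `n : ℕ`. [cite: MontgomeryVaughan2007, Theorem 9.13] -/
theorem apply_natCast_eq_jacobiSym_of_charZero {q : ℕ} [NeZero q] (hodd : Odd q) (hsq : Squarefree q)
    (χ : DirichletCharacter R q) (hprim : χ.IsPrimitive) (hquad : χ.IsQuadratic) (n : ℕ) :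
    χ (n : ZMod q) = (J((n : ℤ) | q) : R) := by
  obtain ⟨v, χ', hv, hχ', hquad', hprim'⟩ := exists_complex_twin χ hquad
  have h := apply_natCast_eq_jacobiSym hodd hsq χ' (hprim'.mp hprim) hquad' n
  rw [hχ'] at h
  rw [hv]
  exact_mod_cast (show v n = J((n : ℤ) | q) by exact_mod_cast h)

/-- **Odd modulus ⟹ squarefree** for a primitive quadratic character with values in a commutative ring of characteristic `0`.
[cite: MontgomeryVaughan2007, Theorem 9.13] -/
theorem squarefree_of_isPrimitive_of_isQuadratic_of_charZero {q : ℕ} [NeZero q] (hodd : Odd q)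
    {χ : DirichletCharacter R q} (hprim : χ.IsPrimitive) (hquad : χ.IsQuadratic) : Squarefree q := by
  obtain ⟨v, χ', -, -, hquad', hprim'⟩ := exists_complex_twin χ hquad
  exact squarefree_of_isPrimitive_of_isQuadratic hodd (hprim'.mp hprim) hquad'

/-- **Even modulus ⟹ `4 ∣ q`** for a primitive quadratic character with values in a commutative ring of characteristic `0`.
[cite: MontgomeryVaughan2007, Theorem 9.13] -/
theorem four_dvd_of_isPrimitive_of_charZero {q : ℕ} [NeZero q] (heven : Even q) {χ : DirichletCharacter R q}
    (hprim : χ.IsPrimitive) (hquad : χ.IsQuadratic) : 4 ∣ q := by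
  obtain ⟨v, χ', -, -, -, hprim'⟩ := exists_complex_twin χ hquad
  exact four_dvd_of_isPrimitive_of_even heven (hprim'.mp hprim)

/-- **A primitive quadratic character is the Kronecker symbol `(D/·)`, `D = χ(−1)·q`, at odd arguments** — values in any
commutative ring of characteristic `0`; `s = χ(−1) ∈ {±1}` given as an integer. [cite: MontgomeryVaughan2007, Theorem 9.13] -/
theorem apply_natCast_eq_jacobiSym_sign_mul_of_charZero {q : ℕ} [NeZero q] {χ : DirichletCharacter R q}
    (hprim : χ.IsPrimitive) (hquad : χ.IsQuadratic) {s : ℤ} (hs : χ (-1) = (s : R)) (hs1 : s = 1 ∨ s = -1)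
    {n : ℕ} (hn : Odd n) : χ (n : ZMod q) = (J(s * q | n) : R) := by
  obtain ⟨v, χ', hv, hχ', hquad', hprim'⟩ := exists_complex_twin χ hquad
  have h := apply_natCast_eq_jacobiSym_sign_mul (hprim'.mp hprim) hquad' (twin_sign hv hχ' hs) hs1 hn
  rw [hχ'] at h
  rw [hv]
  exact_mod_cast (show v n = J(s * q | n) by exact_mod_cast h)

/-- **`D = χ(−1)·q` is a fundamental discriminant** (`q > 1`) for a primitive quadratic character with values in a
commutative ring of characteristic `0` (the predicate spelled as in `QuadraticFields/FundamentalDiscriminant.lean`).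
[cite: MontgomeryVaughan2007, Theorem 9.13] -/
theorem isFundamentalDiscriminant_sign_mul_of_charZero {q : ℕ} [NeZero q] {χ : DirichletCharacter R q}
    (hprim : χ.IsPrimitive) (hquad : χ.IsQuadratic) {s : ℤ} (hs : χ (-1) = (s : R)) (hs1 : s = 1 ∨ s = -1)
    (h1 : 1 < q) :
    ((s * q : ℤ) % 4 = 1 ∧ Squarefree (s * q : ℤ) ∧ (s * q : ℤ) ≠ 1) ∨
      (4 ∣ (s * q : ℤ) ∧ ((s * q : ℤ) / 4 % 4 = 2 ∨ (s * q : ℤ) / 4 % 4 = 3) ∧ Squarefree ((s * q : ℤ) / 4)) := by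
  obtain ⟨v, χ', hv, hχ', hquad', hprim'⟩ := exists_complex_twin χ hquad
  exact isFundamentalDiscriminant_sign_mul (hprim'.mp hprim) hquad' (twin_sign hv hχ' hs) hs1 h1

/-- **The value at `2` for odd modulus `q > 1`**: `χ(2) = 1` if `χ(−1)·q ≡ 1 (mod 8)` and `−1` otherwise (the Kronecker
symbol `(D/2)`), values in any commutative ring of characteristic `0`. [cite: Cox2013, §1.C Lemma 1.14] -/
theorem apply_two_eq_ite_sign_mul_of_charZero {q : ℕ} [NeZero q] (hq : Odd q) (h1 : 1 < q)
    {χ : DirichletCharacter R q} (hprim : χ.IsPrimitive) (hquad : χ.IsQuadratic) {s : ℤ} (hs : χ (-1) = (s : R))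
    (hs1 : s = 1 ∨ s = -1) : χ (2 : ZMod q) = if (s * q : ℤ) % 8 = 1 then 1 else -1 := by
  obtain ⟨v, χ', hv, hχ', hquad', hprim'⟩ := exists_complex_twin χ hquad
  have h := apply_two_eq_ite_sign_mul hq h1 (hprim'.mp hprim) hquad' (twin_sign hv hχ' hs) hs1
  rw [hχ'] at h
  rw [hv]
  split_ifs at h ⊢ with h8
  · exact_mod_cast (show v 2 = 1 by exact_mod_cast h)
  · exact_mod_cast (show v 2 = -1 by exact_mod_cast h)

end Literature.NumberTheory.LFunctions.PrimitiveQuadratic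

end
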